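import Summits.NavierStokesRegularity.NavierStokesRegularity.Theorems.LerayQuarterDissipationFiniteDissipationLiouvillePersistenceSeq
import HarnessLib

/-!
# Crux `FiniteDissipationLiouville` (stmt-NavierStokesRegularity-22144), calm-slice leaf, II:
# the unsteadiness is scale invariant — a calm slice at `t < 0` rescales to a calm slice at `−1`

Theorems file of route `LerayQuarterDissipation` (seat ns-lqd-p2 g4; `--supports` the crux; brick
2/4 of the CALM-SLICE LEAF = the content of `OneCalmSlice`, stmt-NavierStokesRegularity-24375 of
the sister route `CalmSliceGate`). Navier–Stokes regularity is NOT proved here; no summit is.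

The route's UNSTEADINESS of a field `w` at `(t, x)`, `t < 0`, is the vector
`√(−t) • ((−t) • ∂ₜw(t,x) − ½ w(t,x) − ½ Dw(t)(x)[x])`; in backward similarity variables
`w(x,t) = (−t)^{-1/2} U(x/√(−t), s)`, `s = −log(−t)`, it is `∂ₛU(y, s)` at `y = x/√(−t)`
(Pineau–Vicol 2026, §1.3). Under the Navier–Stokes rescaling `w_μ(τ, y) = μ w(μ²τ, μy)`
(`nsRescale`) with `μ = √(−t)` the slice `t` of `w` becomes the slice `−1` of `w_μ`, and

* `deriv_time_nsRescale` — `∂_τ w_μ(−1, y) = μ³ ∂ₜw(t, μy)` (chain rule; the time line is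
  differentiable because the class is jointly smooth on the open slab);
* `unsteadiness_nsRescale` — the unsteadiness of `w_μ` at `(−1, y)` (where `√1 = 1`) EQUALS
  the unsteadiness of `w` at `(t, μy)`;
* `calm_nsRescale` — hence a `(δ, R)`-calm slice of `w` at `t` (unsteadiness `≤ δ` on
  `B(0, R√(−t))`) is a `(δ, R)`-calm slice of `w_μ` at `−1` (on `B(0, R)`).

References: Pineau–Vicol, arXiv:2607.09619, §1.3 (similarity variables); KNSS, Acta Math. 203
(2009) = arXiv:0709.3599, §1 (1.2) (the scaling symmetry).
-/

noncomputable section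

-- the summit and its single sub-problem share the name (CONVENTIONS §1), as in every Theorems file
set_option linter.dupNamespace false

namespace Summit.NavierStokesRegularity.NavierStokesRegularity.Theorems.FiniteDissipationLiouville.CalmSlice

open MeasureTheory Set Filter Topology Metric Function
open Literature.Analysis Literature.Analysis.FluidPDE
open scoped ENNReal NNReal

/-- **Time lines of a class member are differentiable**: for `t < 0` and `x`, the map
`τ ↦ w τ x` is differentiable at `t` (the class is jointly `C^∞` on the open slab
`(−∞, 0) × ℝ³`). [cite: KochNadirashviliSereginSverak2009, Prop. 4.1 (arXiv:0709.3599 p. 8)] -/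
theorem differentiableAt_time {C : ℝ}
    {w : ℝ → EuclideanSpace ℝ (Fin 3) → EuclideanSpace ℝ (Fin 3)}
    (hw : IsTypeIAncientMild C w) {t : ℝ} (ht : t < 0) (x : EuclideanSpace ℝ (Fin 3)) :
    DifferentiableAt ℝ (fun τ => w τ x) t := by
  have hopen : IsOpen ((Iio (0 : ℝ)) ×ˢ (univ : Set (EuclideanSpace ℝ (Fin 3)))) :=
    isOpen_Iio.prod isOpen_univ
  have hmem : ((t, x) : ℝ × EuclideanSpace ℝ (Fin 3)) ∈ (Iio (0 : ℝ)) ×ˢ univ :=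
    ⟨mem_Iio.2 ht, mem_univ _⟩
  have h1 : DifferentiableAt ℝ (uncurry w) (t, x) :=
    ((hw.contDiffOn.contDiffAt (hopen.mem_nhds hmem)).differentiableAt (by simp))
  have h2 : DifferentiableAt ℝ (fun τ : ℝ => ((τ, x) : ℝ × EuclideanSpace ℝ (Fin 3))) t :=
    differentiableAt_id.prodMk (differentiableAt_const x)
  exact h1.comp t h2

/-- **Time derivative of the rescaled field**: for `t < 0`, `μ = √(−t)` and
`w_μ(τ, y) = μ • w(μ²τ, μ•y)`, one has `∂_τ w_μ(−1, y) = μ • (μ² • ∂ₜw(t, μ•y))` (chain rule,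
`μ² · (−1) = t`). [cite: KochNadirashviliSereginSverak2009, §1 (1.2) (arXiv:0709.3599 p. 2)] -/
theorem deriv_time_nsRescale {C : ℝ}
    {w : ℝ → EuclideanSpace ℝ (Fin 3) → EuclideanSpace ℝ (Fin 3)}
    (hw : IsTypeIAncientMild C w) {t : ℝ} (ht : t < 0) (y : EuclideanSpace ℝ (Fin 3)) :
    deriv (fun τ => nsRescale (Real.sqrt (-t)) w τ y) (-1) =
      Real.sqrt (-t) • ((-t) • deriv (fun τ => w τ (Real.sqrt (-t) • y)) t) := by
  set μ : ℝ := Real.sqrt (-t) with hμ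
  have hμ2 : μ ^ 2 = -t := by rw [hμ, Real.sq_sqrt (neg_nonneg.2 ht.le)]
  have hμt : μ ^ 2 * (-1) = t := by rw [hμ2]; ring
  set g : ℝ → EuclideanSpace ℝ (Fin 3) := fun σ => w σ (μ • y) with hg
  have hgd : HasDerivAt g (deriv g t) t := (differentiableAt_time hw ht (μ • y)).hasDerivAt
  have hgd' : HasDerivAt g (deriv g t) (μ ^ 2 * (-1)) := by rw [hμt]; exact hgd
  have h1 : HasDerivAt (fun τ : ℝ => μ ^ 2 * τ) (μ ^ 2) (-1) := by
    simpa using (hasDerivAt_id (-1 : ℝ)).const_mul (μ ^ 2)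
  have h2 : HasDerivAt (fun τ : ℝ => g (μ ^ 2 * τ)) (μ ^ 2 • deriv g t) (-1) :=
    hgd'.scomp (-1) h1
  have h3 : HasDerivAt (fun τ : ℝ => μ • g (μ ^ 2 * τ)) (μ • (μ ^ 2 • deriv g t)) (-1) :=
    h2.const_smul μ
  have e : (fun τ => nsRescale μ w τ y) = fun τ : ℝ => μ • g (μ ^ 2 * τ) := by
    funext τ; simp only [nsRescale_apply, hg]
  rw [e, h3.deriv, hμ2]

/-- **The unsteadiness is scale invariant.** For `t < 0`, `μ = √(−t)`: the unsteadiness of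
`w_μ = nsRescale μ w` at `(−1, y)`,
`∂_τ w_μ(−1,y) − ½ w_μ(−1,y) − ½ D(w_μ(−1))(y)[y]`, equals the unsteadiness of `w` at `(t, μy)`,
`√(−t) • ((−t) • ∂ₜw(t,x) − ½ w(t,x) − ½ Dw(t)(x)[x])`, `x = μ • y` — both are `∂ₛU` of the
common similarity profile (Pineau–Vicol 2026, §1.3). [cite: KochNadirashviliSereginSverak2009, §1 (1.2) (arXiv:0709.3599 p. 2)] -/
theorem unsteadiness_nsRescale {C : ℝ}
    {w : ℝ → EuclideanSpace ℝ (Fin 3) → EuclideanSpace ℝ (Fin 3)}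
    (hw : IsTypeIAncientMild C w) {t : ℝ} (ht : t < 0) (y : EuclideanSpace ℝ (Fin 3)) :
    deriv (fun τ => nsRescale (Real.sqrt (-t)) w τ y) (-1) -
        (1 / 2 : ℝ) • nsRescale (Real.sqrt (-t)) w (-1) y -
        (1 / 2 : ℝ) • fderiv ℝ (nsRescale (Real.sqrt (-t)) w (-1)) y y =
      Real.sqrt (-t) • ((-t) • deriv (fun τ => w τ (Real.sqrt (-t) • y)) t -
        (1 / 2 : ℝ) • w t (Real.sqrt (-t) • y) -
        (1 / 2 : ℝ) • fderiv ℝ (w t) (Real.sqrt (-t) • y) (Real.sqrt (-t) • y)) := by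
  set μ : ℝ := Real.sqrt (-t) with hμ
  have hμ2 : μ ^ 2 = -t := by rw [hμ, Real.sq_sqrt (neg_nonneg.2 ht.le)]
  have hμt : μ ^ 2 * (-1) = t := by rw [hμ2]; ring
  rw [deriv_time_nsRescale hw ht y, RecurrentReductionD.fderiv_nsRescale, nsRescale_apply, hμt]
  have hL : fderiv ℝ (w t) (μ • y) (μ • y) = μ • fderiv ℝ (w t) (μ • y) y :=
    (fderiv ℝ (w t) (μ • y)).map_smul μ y
  have hS : ((μ * μ) • fderiv ℝ (w t) (μ • y)) y = (μ * μ) • fderiv ℝ (w t) (μ • y) y := rfl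
  rw [hL, hS, ← sq]
  generalize deriv (fun τ => w τ (μ • y)) t = D
  generalize w t (μ • y) = a
  generalize fderiv ℝ (w t) (μ • y) y = b
  module

/-- **A calm slice rescales to a calm slice at `−1`.** If the unsteadiness of `w` at time `t < 0`
is `≤ δ` on the similarity ball `B(0, R√(−t))`, then the unsteadiness of `w_μ = nsRescale √(−t) w`
at time `−1` is `≤ δ` on `B(0, R)`. [cite: KochNadirashviliSereginSverak2009, §1 (1.2) (arXiv:0709.3599 p. 2)] -/
theorem calm_nsRescale {C : ℝ}
    {w : ℝ → EuclideanSpace ℝ (Fin 3) → EuclideanSpace ℝ (Fin 3)}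
    (hw : IsTypeIAncientMild C w) {t δ R : ℝ} (ht : t < 0)
    (hcalm : ∀ x ∈ ball (0 : EuclideanSpace ℝ (Fin 3)) (R * Real.sqrt (-t)),
      ‖Real.sqrt (-t) • ((-t) • deriv (fun τ => w τ x) t - (1 / 2 : ℝ) • w t x -
        (1 / 2 : ℝ) • fderiv ℝ (w t) x x)‖ ≤ δ) :
    ∀ y ∈ ball (0 : EuclideanSpace ℝ (Fin 3)) R,
      ‖deriv (fun τ => nsRescale (Real.sqrt (-t)) w τ y) (-1) -
          (1 / 2 : ℝ) • nsRescale (Real.sqrt (-t)) w (-1) y -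
          (1 / 2 : ℝ) • fderiv ℝ (nsRescale (Real.sqrt (-t)) w (-1)) y y‖ ≤ δ := by
  intro y hy
  have hμ : 0 < Real.sqrt (-t) := Real.sqrt_pos.2 (neg_pos.2 ht)
  rw [unsteadiness_nsRescale hw ht y]
  refine hcalm (Real.sqrt (-t) • y) ?_
  rw [mem_ball_zero_iff] at hy ⊢
  rw [norm_smul, Real.norm_of_nonneg hμ.le, mul_comm]
  exact mul_lt_mul_of_pos_right hy hμ

end Summit.NavierStokesRegularity.NavierStokesRegularity.Theorems.FiniteDissipationLiouville.CalmSlice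

end
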